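import Literature.Computability.AlgebraicComplexity.InterfaceTensors
import HarnessLib

/-!
# Matrix multiplication terms of an interface tensor
(Vassilevska Williams–Xu–Xu–Zhou 2024, Thm. 6.1) — the structural half, proved

Topic `Literature/Computability/AlgebraicComplexity`.  §6 of Vassilevska Williams–Xu–Xu–Zhou,
*New bounds for matrix multiplication: from alpha to omega* (SODA 2024, arXiv:2307.07970), opens the
constituent stage by disposing of the terms of the input interface tensor one of whose level-`ℓ`
indices vanishes:

> **Theorem 6.1.** If `k_t = 0`, then `T_{i_t,j_t,k_t}^{⊗ n_t}[γ_X^{(t)}, γ_Y^{(t)}, γ_Z^{(t)}, ε] ≡ ⟨1, M, 1⟩`,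
> where `M = 2^{n_t (H(γ_X^{(t)}) ± o_{1/ε}(1)) ± o(n)} · q^{n_t ∑_σ γ_X^{(t)}(σ) ∑_p [σ_p = 1]}`.
> Similar results hold when `i_t = 0` or `j_t = 0`.
>
> *Proof.* As `k_t = 0`, there is only one `Z`-variable `z₀` in the given tensor. Also, for each fixed
> `X`-variable `x`, there is a unique `Y`-variable `y` so that `x y z₀` is a term in the given tensor
> (this is because it is a subtensor of `CW_q^{⊗N}`), and vice versa. Thus, the given tensor is
> isomorphic to an inner product tensor `⟨1, M, 1⟩` for some `M ≥ 0`. It remains to calculate the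
> number of `X`-variables …

This file PROVES the structural statement exactly as printed, for the one-term interface tensor
`cwSplitTerm K q T ε` of `InterfaceTensors.lean` (Def. 3.6) with `T.k = 0`, together with the EXACT
count of its variables; the asymptotic evaluation of `M` (entropy of `γ_X`, Lemma 3.3) is not done here.

* `cwDual` — the involution `a ↦ ā` of the indices of `CW_q` (`x₀ ↔ x_{q+1}`, `x_i ↦ x_i`) with
  `CW_q(a, b, x₀) = [b = ā]` (`bigCwTensor_zero_right`): "for each `x` there is a unique `y`";
  `cwLevel (ā) = 2 − cwLevel a`; on sequences `cwDualSeq`, with level sequence `revSeq` (`2 − Î`).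
* `cwSplitTerm_apply_of_k_eq_zero` — for `T.k = 0` the term is the `0/1` tensor
  `[x, y, z admissible] · [y = x̄] · [z = z₀]` (`z₀ = 0`, the all-`x₀` variable, is the only
  candidate `Z`-variable: `eq_zero_of_mem_termBlocksZ`).
* `mmTermVars` — the `X`-variables of the term: admissible `x` whose partner `x̄` is an admissible
  `Y`-variable; `vxxz2024_thm61_iso` — **if `z₀` is admissible, the term and the matrix
  multiplication tensor `⟨M, 1, 1⟩` (`matMulTensor K M 1 1`, the tree's placement of the inner
  product tensor `⟨1, M, 1⟩` with trivial third slot), `M = |mmTermVars|`, RESTRICT TO EACH OTHER**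
  (are isomorphic); otherwise the term is `0` (`cwSplitTerm_eq_zero_of_not_mem`).
* `card_mmTermVars` — **`M = ∑_{Î} q^{#{(u,p) | Î_{u,p} = 1}}`** over the admissible level-1
  `X`-sequences `Î` whose reversal `2 − Î` is an admissible `Y`-sequence (a level-1 block `X_Î` has
  `q^{#1's}` variables, `card_filter_levelSeq_eq`: the printed "In each of these level-1 blocks, say
  `X_Î`, the number of `X`-variables is `q^{∑_p [Î_p = 1]}`"); and under the input constraints of §6
  (`i_t + j_t = 2^ℓ`, `γ_Y^{(t)}(σ) = γ_X^{(t)}(2 − σ)` for `k_t = 0`) the reversal condition is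
  automatic (`revSeq_mem_termBlocksY_iff`), so `M = ∑_{Î ∈ X-blocks} q^{#1's(Î)}` (`card_mmTermVars_of_symm`).

* `vxxz2024_thm61_card` — **the printed `M` exactly, at `ε = 0`**: for `n ≥ 1` chunks, `γ_X = k/n` the
  type of a word supported on shapes of level `i` (first input constraint of §6) and the symmetry
  constraint, the level-1 `X`-blocks form ONE type class (`termBlocksX_zero_eq_typeClass`), so
  `M = binom(n; k) · q^{∑_σ k(σ) #1's(σ)}` (`binom(n; nγ_X) = 2^{n(H(γ_X) ± o(1))}` is Lemma 3.3,
  `MultinomialEntropy.lean`; the `o_{1/ε}` terms of the printed `M` only enter for `ε > 0`).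

Everything is proved; no named facts.

## References

* V. Vassilevska Williams, Y. Xu, Z. Xu, R. Zhou, *New bounds for matrix multiplication: from alpha
  to omega*, SODA 2024, arXiv:2307.07970 (held: `paper:arxiv-2307.07970`), §6 (input constraints of
  the constituent stage), Thm. 6.1 and its proof. [VassilevskaWilliamsXuXuZhou2024]
* V. Vassilevska Williams, *Multiplying matrices faster than Coppersmith–Winograd*, STOC 2012 (the
  version without complete split distributions, cited loc. cit.). [Williams2012]
-/

noncomputable section

open scoped BigOperators
open Finset

namespace Literature.Computability.AlgebraicComplexity

open Literature.Barriers.MatrixMultiplication (bigCwTensor bigCwTensor_apply)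

universe u

/-! ## The involution `a ↦ ā` of the indices of `CW_q` -/

section Dual

variable {q : ℕ}

/-- **The partner `ā` of an index of `CW_q`**: `x₀ ↔ x_{q+1}`, `x_i ↦ x_i` (`1 ≤ i ≤ q`) — the unique
`b` with `x_a y_b z_0` in the support of `CW_q`. [cite: VassilevskaWilliamsXuXuZhou2024, Thm. 6.1 (proof: "for each fixed X-variable x there is a unique Y-variable y")] -/
def cwDual (a : Fin (q + 2)) : Fin (q + 2) :=
  if a = 0 then Fin.last (q + 1) else if a = Fin.last (q + 1) then 0 else a

/-- `x_{q+1} ≠ x₀`. [folklore] -/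
private theorem last_ne_zero' : Fin.last (q + 1) ≠ (0 : Fin (q + 2)) := by simp [Fin.ext_iff]

/-- `x̄₀ = x_{q+1}`. [folklore] -/
@[simp] theorem cwDual_zero : cwDual (0 : Fin (q + 2)) = Fin.last (q + 1) := by simp [cwDual]

/-- `x̄_{q+1} = x₀`. [folklore] -/
@[simp] theorem cwDual_last : cwDual (Fin.last (q + 1)) = 0 := by
  have := (last_ne_zero' (q := q))
  simp [cwDual, this]

/-- The middle indices are self-dual. [folklore] -/
theorem cwDual_of_ne {a : Fin (q + 2)} (h0 : a ≠ 0) (hl : a ≠ Fin.last (q + 1)) : cwDual a = a := by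
  simp [cwDual, h0, hl]

/-- `a ↦ ā` is an involution. [folklore] -/
@[simp] theorem cwDual_cwDual (a : Fin (q + 2)) : cwDual (cwDual a) = a := by
  by_cases h0 : a = 0
  · subst h0; simp
  · by_cases hl : a = Fin.last (q + 1)
    · subst hl; simp
    · rw [cwDual_of_ne h0 hl, cwDual_of_ne h0 hl]

/-- `a ↦ ā` is injective. [folklore] -/
theorem cwDual_injective : Function.Injective (cwDual : Fin (q + 2) → Fin (q + 2)) :=
  Function.Involutive.injective cwDual_cwDual

/-- Levels of partners: `level(ā) = 2 − level(a)`. [cite: VassilevskaWilliamsXuXuZhou2024, §6 (input constraints: γ_X(î) = γ_Z(2 − î))] -/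
theorem cwLevel_cwDual (a : Fin (q + 2)) : cwLevel (cwDual a) = 2 - cwLevel a := by
  by_cases h0 : a = 0
  · subst h0; simp
  · by_cases hl : a = Fin.last (q + 1)
    · subst hl; simp
    · rw [cwDual_of_ne h0 hl]
      simp [cwLevel, h0, hl]

/-- `cwLevel₃ ā = rev (cwLevel₃ a)` (`rev i = 2 − i` on `Fin 3`). [folklore] -/
theorem cwLevel₃_cwDual (a : Fin (q + 2)) : cwLevel₃ (cwDual a) = (cwLevel₃ a).rev := by
  apply Fin.ext
  rw [cwLevel₃_val, cwLevel_cwDual, Fin.val_rev, cwLevel₃_val]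
  have := cwLevel_le_two a
  omega

variable (K : Type u) [CommSemiring K]

/-- **The slice `z = x₀` of `CW_q` is the graph of `a ↦ ā`**: `CW_q(a, b, x₀) = [b = ā]`
(the terms `x₀ y_{q+1} z₀`, `x_{q+1} y₀ z₀`, `x_i y_i z₀`). [cite: VassilevskaWilliamsXuXuZhou2024, Thm. 6.1 (proof)] -/
theorem bigCwTensor_zero_right (q : ℕ) (a b : Fin (q + 2)) :
    bigCwTensor K q a b 0 = if b = cwDual a then 1 else 0 := by
  rw [bigCwTensor_apply]
  have hl : Fin.last (q + 1) ≠ (0 : Fin (q + 2)) := last_ne_zero'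
  by_cases h0 : a = 0
  · subst h0
    by_cases hb : b = Fin.last (q + 1)
    · subst hb; simp [hl]
    · simp [hb, hl.symm, cwDual_zero]
  · by_cases ha : a = Fin.last (q + 1)
    · subst ha
      by_cases hb : b = 0
      · subst hb; simp [hl]
      · simp [hb, hl, cwDual_last]
    · rw [cwDual_of_ne h0 ha]
      by_cases hb : b = a
      · subst hb; simp [h0, ha]
      · simp [hb, h0, ha, Ne.symm hb, hl.symm]

end Dual

/-! ## Partners of variables and reversal of level sequences -/

section DualSeq

variable {q c n : ℕ}

/-- The partner `x̄` of a variable of `(CW_q^{⊗c})^{⊗n}` (entrywise `a ↦ ā`). [cite: VassilevskaWilliamsXuXuZhou2024, Thm. 6.1 (proof)] -/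
def cwDualSeq (x : Fin n → Fin c → Fin (q + 2)) : Fin n → Fin c → Fin (q + 2) := fun u p => cwDual (x u p)

/-- Entries of the partner. [folklore] -/
@[simp] theorem cwDualSeq_apply (x : Fin n → Fin c → Fin (q + 2)) (u : Fin n) (p : Fin c) :
    cwDualSeq x u p = cwDual (x u p) := rfl

/-- `x ↦ x̄` is an involution. [folklore] -/
@[simp] theorem cwDualSeq_cwDualSeq (x : Fin n → Fin c → Fin (q + 2)) : cwDualSeq (cwDualSeq x) = x := by
  funext u p; simp

/-- `x ↦ x̄` is injective. [folklore] -/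
theorem cwDualSeq_injective :
    Function.Injective (cwDualSeq : (Fin n → Fin c → Fin (q + 2)) → Fin n → Fin c → Fin (q + 2)) :=
  Function.Involutive.injective cwDualSeq_cwDualSeq

/-- **The reversed level-1 sequence `2 − Î`** (entrywise `rev` on `{0,1,2}`). [cite: VassilevskaWilliamsXuXuZhou2024, §6 (input constraints)] -/
def revSeq (I : Fin n → Fin c → Fin 3) : Fin n → Fin c → Fin 3 := fun u p => (I u p).rev

/-- Entries of the reversed sequence. [folklore] -/
@[simp] theorem revSeq_apply (I : Fin n → Fin c → Fin 3) (u : Fin n) (p : Fin c) :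
    revSeq I u p = (I u p).rev := rfl

/-- Reversal is an involution. [folklore] -/
@[simp] theorem revSeq_revSeq (I : Fin n → Fin c → Fin 3) : revSeq (revSeq I) = I := by
  funext u p; simp

/-- The level-1 sequence of the partner is the reversed level-1 sequence. [cite: VassilevskaWilliamsXuXuZhou2024, §6] -/
theorem levelSeq_cwDualSeq (x : Fin n → Fin c → Fin (q + 2)) : levelSeq (cwDualSeq x) = revSeq (levelSeq x) := by
  funext u p
  simp [cwLevel₃_cwDual]

/-- Level-`ℓ` indices of reversed shapes: `level(2 − σ) = 2c − level(σ)`. [cite: VassilevskaWilliamsXuXuZhou2024, §6] -/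
theorem patternLevel_rev (σ : Fin c → Fin 3) : patternLevel (fun p => (σ p).rev) + patternLevel σ = 2 * c := by
  unfold patternLevel
  rw [← sum_add_distrib]
  calc ∑ p, (((σ p).rev : ℕ) + (σ p : ℕ)) = ∑ _p : Fin c, 2 := sum_congr rfl fun p _ => by
        rw [Fin.val_rev]; have := (σ p).isLt; omega
    _ = 2 * c := by simp [mul_comm]

end DualSeq

/-! ## One-term interface tensors with `k = 0` -/

section TermK

variable {c n : ℕ}

/-- The level-1 `X`-blocks of the one-term interface tensor `T^{⊗n}[γ_X, γ_Y, γ_Z, ε]`. [cite: VassilevskaWilliamsXuXuZhou2024, Def. 3.6] -/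
abbrev termBlocksX (n : ℕ) (T : InterfaceTerm c) (ε : ℝ) : Finset (Fin n → Fin c → Fin 3) :=
  levelBlocksX (fun _ : Fin n => (0 : Fin 1)) (fun _ => T) ε

/-- The level-1 `Y`-blocks of the one-term interface tensor. [cite: VassilevskaWilliamsXuXuZhou2024, Def. 3.6] -/
abbrev termBlocksY (n : ℕ) (T : InterfaceTerm c) (ε : ℝ) : Finset (Fin n → Fin c → Fin 3) :=
  levelBlocksY (fun _ : Fin n => (0 : Fin 1)) (fun _ => T) ε

/-- The level-1 `Z`-blocks of the one-term interface tensor. [cite: VassilevskaWilliamsXuXuZhou2024, Def. 3.6] -/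
abbrev termBlocksZ (n : ℕ) (T : InterfaceTerm c) (ε : ℝ) : Finset (Fin n → Fin c → Fin 3) :=
  levelBlocksZ (fun _ : Fin n => (0 : Fin 1)) (fun _ => T) ε

variable {q : ℕ}

/-- **"As `k_t = 0`, there is only one `Z`-variable `z₀`"**: a `Z`-variable kept by a term with
`k = 0` has all its indices at level `0`, i.e. is the all-`x₀` variable `0`. [cite: VassilevskaWilliamsXuXuZhou2024, Thm. 6.1 (proof)] -/
theorem eq_zero_of_mem_termBlocksZ {T : InterfaceTerm c} (hT : T.k = 0) {ε : ℝ}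
    {z : Fin n → Fin c → Fin (q + 2)} (hz : levelSeq z ∈ termBlocksZ n T ε) : z = 0 := by
  have h := (mem_admissibleSeqs.1 hz).1
  funext u p
  have hu := h u
  rw [hT, patternLevel_levelSeq] at hu
  have hp : cwLevel (z u p) = 0 := by
    have := (sum_eq_zero_iff.1 hu) p (mem_univ _)
    exact this
  exact (cwLevel_eq_zero_iff _).1 hp

/-- **A term with `k = 0` is the graph of `x ↦ x̄` on its variables**:
`T^{⊗n}[γ_X,γ_Y,γ_Z,ε](x, y, z) = [x, y, z admissible] · [y = x̄]` (and then `z = z₀`).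
[cite: VassilevskaWilliamsXuXuZhou2024, Thm. 6.1 (proof)] -/
theorem cwSplitTerm_apply_of_k_eq_zero (K : Type u) [CommSemiring K] (q : ℕ) (T : InterfaceTerm c)
    (hT : T.k = 0) (ε : ℝ) (x y z : Fin n → Fin c → Fin (q + 2)) :
    cwSplitTerm K q T ε x y z =
      if (levelSeq x ∈ termBlocksX n T ε ∧ levelSeq y ∈ termBlocksY n T ε ∧
          levelSeq z ∈ termBlocksZ n T ε) ∧ y = cwDualSeq x then 1 else 0 := by
  rw [cwSplitTerm, interfaceTensor_apply]
  by_cases hadm : levelSeq x ∈ termBlocksX n T ε ∧ levelSeq y ∈ termBlocksY n T ε ∧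
      levelSeq z ∈ termBlocksZ n T ε
  · rw [if_pos hadm]
    have hz : z = 0 := eq_zero_of_mem_termBlocksZ hT hadm.2.2
    have hz' : ∀ u p, z u p = 0 := fun u p => by rw [hz]; rfl
    by_cases hy : y = cwDualSeq x
    · rw [if_pos ⟨hadm, hy⟩]
      refine Finset.prod_eq_one fun u _ => Finset.prod_eq_one fun p _ => ?_
      rw [hz', hy, cwDualSeq_apply, bigCwTensor_zero_right, if_pos rfl]
    · rw [if_neg fun h => hy h.2]
      obtain ⟨u, hu⟩ := Function.ne_iff.1 hy
      obtain ⟨p, hp⟩ := Function.ne_iff.1 hu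
      refine Finset.prod_eq_zero (mem_univ u) (Finset.prod_eq_zero (mem_univ p) ?_)
      rw [hz', bigCwTensor_zero_right, if_neg]
      simpa using hp
  · rw [if_neg hadm, if_neg fun h => hadm h.1]

/-- **The `X`-variables of a term with `k = 0`**: admissible `x` whose partner `x̄` is an admissible
`Y`-variable (its `M` variables, Thm. 6.1). [cite: VassilevskaWilliamsXuXuZhou2024, Thm. 6.1] -/
def mmTermVars (q n : ℕ) (T : InterfaceTerm c) (ε : ℝ) : Finset (Fin n → Fin c → Fin (q + 2)) :=
  univ.filter fun x => levelSeq x ∈ termBlocksX n T ε ∧ levelSeq (cwDualSeq x) ∈ termBlocksY n T ε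

/-- Membership in the `X`-variables of the term. [cite: VassilevskaWilliamsXuXuZhou2024, Thm. 6.1] -/
theorem mem_mmTermVars {T : InterfaceTerm c} {ε : ℝ} {x : Fin n → Fin c → Fin (q + 2)} :
    x ∈ mmTermVars q n T ε ↔ levelSeq x ∈ termBlocksX n T ε ∧ levelSeq (cwDualSeq x) ∈ termBlocksY n T ε := by
  simp [mmTermVars]

/-- Outside admissible `z₀` the term vanishes identically. [cite: VassilevskaWilliamsXuXuZhou2024, Thm. 6.1 (proof)] -/
theorem cwSplitTerm_eq_zero_of_not_mem (K : Type u) [CommSemiring K] (q : ℕ) (T : InterfaceTerm c)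
    (hT : T.k = 0) (ε : ℝ) (hz : levelSeq (0 : Fin n → Fin c → Fin (q + 2)) ∉ termBlocksZ n T ε) :
    cwSplitTerm (n := n) K q T ε = 0 := by
  funext x y z
  rw [cwSplitTerm_apply_of_k_eq_zero K q T hT ε, if_neg]
  · rfl
  · rintro ⟨⟨-, -, h⟩, -⟩
    have := eq_zero_of_mem_termBlocksZ hT h
    subst this
    exact hz h

/-- The support of a term with `k = 0`: a non-zero entry has `x ∈ mmTermVars`, `ȳ ∈ mmTermVars`,
`z = z₀`. [cite: VassilevskaWilliamsXuXuZhou2024, Thm. 6.1 (proof)] -/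
theorem cwSplitTerm_support_of_k_eq_zero (K : Type u) [CommSemiring K] (q : ℕ) (T : InterfaceTerm c)
    (hT : T.k = 0) (ε : ℝ) {x y z : Fin n → Fin c → Fin (q + 2)} (h : cwSplitTerm K q T ε x y z ≠ 0) :
    x ∈ mmTermVars q n T ε ∧ cwDualSeq y ∈ mmTermVars q n T ε ∧ z = 0 := by
  rw [cwSplitTerm_apply_of_k_eq_zero K q T hT ε] at h
  by_cases hc : (levelSeq x ∈ termBlocksX n T ε ∧ levelSeq y ∈ termBlocksY n T ε ∧
      levelSeq z ∈ termBlocksZ n T ε) ∧ y = cwDualSeq x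
  · obtain ⟨⟨hx, hy, hz⟩, rfl⟩ := hc
    refine ⟨mem_mmTermVars.2 ⟨hx, hy⟩, ?_, eq_zero_of_mem_termBlocksZ hT hz⟩
    rw [cwDualSeq_cwDualSeq, mem_mmTermVars]
    exact ⟨hx, hy⟩
  · exact absurd (if_neg hc) h

/-- **VXXZ 2024, Theorem 6.1 (structural part): a term with `k_t = 0` is isomorphic to the inner
product tensor `⟨1, M, 1⟩`.**  For the one-term interface tensor `𝒯 = T^{⊗n}[γ_X, γ_Y, γ_Z, ε]`
(`cwSplitTerm`, Def. 3.6) with `T.k = 0` and admissible `z₀`, and `M = |mmTermVars|` the number of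
its `X`-variables, `𝒯 ≥ ⟨M, 1, 1⟩` and `⟨M, 1, 1⟩ ≥ 𝒯` (restrictions both ways: the two tensors are
isomorphic up to zero padding; `matMulTensor K M 1 1` is the tree's placement of `⟨1, M, 1⟩`, the
`M`-term inner product with trivial third slot).  The cases `i_t = 0`, `j_t = 0` are symmetric.
[cite: VassilevskaWilliamsXuXuZhou2024, Thm. 6.1] -/
theorem vxxz2024_thm61_iso (K : Type u) [CommSemiring K] (q : ℕ) (T : InterfaceTerm c) (hT : T.k = 0)
    (ε : ℝ) (hz : levelSeq (0 : Fin n → Fin c → Fin (q + 2)) ∈ termBlocksZ n T ε) :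
    TensorRestrictsTo (cwSplitTerm (n := n) K q T ε) (matMulTensor K (mmTermVars q n T ε).card 1 1) ∧
      TensorRestrictsTo (matMulTensor K (mmTermVars q n T ε).card 1 1) (cwSplitTerm (n := n) K q T ε) := by
  set V := mmTermVars q n T ε with hV
  -- enumerate the variables
  let e : ↥V ≃ Fin V.card := Fintype.equivFinOfCardEq (Fintype.card_coe V)
  have hval : ∀ (x : ↥V) (y : Fin n → Fin c → Fin (q + 2)), cwDualSeq y ∈ V →
      cwSplitTerm K q T ε x.1 y 0 = if y = cwDualSeq x.1 then 1 else 0 := by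
    intro x y hy
    rw [cwSplitTerm_apply_of_k_eq_zero K q T hT ε]
    have hx := mem_mmTermVars.1 x.2
    have hy' := mem_mmTermVars.1 hy
    rw [cwDualSeq_cwDualSeq] at hy'
    by_cases h : y = cwDualSeq x.1
    · subst h
      rw [if_pos ⟨⟨hx.1, hx.2, by simpa using hz⟩, rfl⟩, if_pos rfl]
    · rw [if_neg fun h' => h h'.2, if_neg h]
  constructor
  · -- `𝒯 ≥ ⟨M,1,1⟩`: the matrix tensor is a coordinate sub-tensor of the term
    have key : matMulTensor K V.card 1 1 = fun a b _c =>
        cwSplitTerm K q T ε (e.symm a.1).1 (cwDualSeq (e.symm b.1).1) 0 := by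
      funext a b c'
      rw [hval (e.symm a.1) _ (by rw [cwDualSeq_cwDualSeq]; exact (e.symm b.1).2)]
      simp only [matMulTensor, cwDualSeq_injective.eq_iff]
      have h2 : b.2 = c'.1 := Subsingleton.elim _ _
      have h3 : a.2 = c'.2 := Subsingleton.elim _ _
      simp only [h2, h3, and_true]
      by_cases hab : a.1 = b.1
      · rw [if_pos hab, if_pos (by rw [hab])]
      · rw [if_neg hab, if_neg]
        intro h
        exact hab (by
          have := congrArg e (Subtype.ext h).symm
          simpa using this)
    rw [key]
    exact TensorRestrictsTo.comap _ _ _ _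
  · -- `⟨M,1,1⟩ ≥ 𝒯`: pad the term from its support and read it off the matrix tensor
    have hext : TensorRestrictsTo (fun (x : {x // x ∈ V}) (y : {y // cwDualSeq y ∈ V})
        (z : {z : Fin n → Fin c → Fin (q + 2) // z = 0}) => cwSplitTerm K q T ε x.1 y.1 z.1)
        (cwSplitTerm (n := n) K q T ε) := by
      convert tensorRestrictsTo_extend_subtype (cwSplitTerm K q T ε) (fun x => x ∈ V)
        (fun y => cwDualSeq y ∈ V) (fun z => z = 0)
        fun x y z h => cwSplitTerm_support_of_k_eq_zero K q T hT ε h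
    have key : (fun (x : {x // x ∈ V}) (y : {y // cwDualSeq y ∈ V}) (z : {z : Fin n → Fin c → Fin (q + 2) // z = 0}) =>
        cwSplitTerm K q T ε x.1 y.1 z.1) = fun x y _z =>
        matMulTensor K V.card 1 1 (e ⟨x.1, x.2⟩, 0) (e ⟨cwDualSeq y.1, y.2⟩, 0) (0, 0) := by
      funext x y z
      obtain ⟨z, rfl⟩ := z
      rw [hval ⟨x.1, x.2⟩ y.1 y.2]
      simp only [matMulTensor, and_true, EmbeddingLike.apply_eq_iff_eq, Subtype.mk.injEq]
      by_cases h : y.1 = cwDualSeq x.1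
      · rw [if_pos h, if_pos (by rw [h, cwDualSeq_cwDualSeq])]
      · rw [if_neg h, if_neg]
        intro h'
        exact h (by rw [h', cwDualSeq_cwDualSeq])
    rw [key] at hext
    exact (TensorRestrictsTo.comap _ _ _ _).trans hext

end TermK

/-! ## Counting the variables: `M = ∑_Î q^{#1's(Î)}` -/

section Count

variable {q c n : ℕ}

/-- The indices of `CW_q` of a given level: one of level `0` (`x₀`), `q` of level `1`, one of level
`2` (`x_{q+1}`) — the block dimensions `cwDim = (1, q, 1)`. [cite: VassilevskaWilliamsXuXuZhou2024, §3.7 (X₀ = {x₀}, X₁ = {x₁,…,x_q}, X₂ = {x_{q+1}})] -/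
theorem card_filter_cwLevel₃_eq (l : Fin 3) :
    (univ.filter fun a : Fin (q + 2) => cwLevel₃ a = l).card = cwDim q l := by
  have hval : ∀ a : Fin (q + 2), cwLevel₃ a = l ↔ cwLevel a = (l : ℕ) := fun a => by
    rw [Fin.ext_iff, cwLevel₃_val]
  simp only [hval]
  have hdim : cwDim q l = if (l : ℕ) = 1 then q else 1 := by
    simp only [cwDim, Fin.ext_iff, Fin.val_one]
  rw [hdim]
  have hl : (l : ℕ) = 0 ∨ (l : ℕ) = 1 ∨ (l : ℕ) = 2 := by have := l.isLt; omega
  rcases hl with h | h | h <;> rw [h]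
  · -- level 0: `{x₀}`
    have : (univ.filter fun a : Fin (q + 2) => cwLevel a = 0) = {0} := by
      ext a; simp [cwLevel_eq_zero_iff]
    rw [this]; simp
  · -- level 1: the image of `cwMid`
    have : (univ.filter fun a : Fin (q + 2) => cwLevel a = 1) = univ.image cwMid := by
      ext a
      simp only [mem_filter, mem_univ, true_and, mem_image]
      rw [cwLevel_eq_one_iff]
      constructor
      · rintro ⟨i, rfl⟩; exact ⟨i, rfl⟩
      · rintro ⟨i, rfl⟩; exact ⟨i, rfl⟩
    rw [this, card_image_of_injective _ fun i j h => cwMid_inj.1 h]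
    simp
  · -- level 2: `{x_{q+1}}`
    have : (univ.filter fun a : Fin (q + 2) => cwLevel a = 2) = {Fin.last (q + 1)} := by
      ext a; simp [cwLevel_eq_two_iff]
    rw [this]; simp

/-- **A level-1 block `X_Î` has `q^{#{(u,p) | Î_{u,p} = 1}}` variables** ("In each of these
level-1 blocks, say `X_Î`, the number of `X`-variables is `q^{∑_p [Î_p = 1]}`").
[cite: VassilevskaWilliamsXuXuZhou2024, Thm. 6.1 (proof, eq. for the number of X-variables in a block)] -/
theorem card_filter_levelSeq_eq (I : Fin n → Fin c → Fin 3) :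
    (univ.filter fun x : Fin n → Fin c → Fin (q + 2) => levelSeq x = I).card =
      q ^ (univ.filter fun up : Fin n × Fin c => I up.1 up.2 = 1).card := by
  classical
  -- as a subtype of functions with coordinatewise level constraints
  have h1 : (univ.filter fun x : Fin n → Fin c → Fin (q + 2) => levelSeq x = I).card =
      Fintype.card {x : Fin n → Fin c → Fin (q + 2) // ∀ u, ∀ p, cwLevel₃ (x u p) = I u p} := by
    rw [Fintype.card_subtype]
    congr 1
    ext x
    simp only [mem_filter, mem_univ, true_and, funext_iff, levelSeq_apply]
  have h2 : Fintype.card {x : Fin n → Fin c → Fin (q + 2) // ∀ u, ∀ p, cwLevel₃ (x u p) = I u p} =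
      ∏ u, ∏ p, cwDim q (I u p) := by
    calc Fintype.card {x : Fin n → Fin c → Fin (q + 2) // ∀ u, ∀ p, cwLevel₃ (x u p) = I u p}
        = Fintype.card ((u : Fin n) → {w : Fin c → Fin (q + 2) // ∀ p, cwLevel₃ (w p) = I u p}) :=
          Fintype.card_congr (Equiv.subtypePiEquivPi
            (p := fun u (w : Fin c → Fin (q + 2)) => ∀ p, cwLevel₃ (w p) = I u p))
      _ = ∏ u, Fintype.card {w : Fin c → Fin (q + 2) // ∀ p, cwLevel₃ (w p) = I u p} :=
          Fintype.card_pi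
      _ = ∏ u, ∏ p, Fintype.card {a : Fin (q + 2) // cwLevel₃ a = I u p} := by
          refine prod_congr rfl fun u _ => ?_
          calc Fintype.card {w : Fin c → Fin (q + 2) // ∀ p, cwLevel₃ (w p) = I u p}
              = Fintype.card ((p : Fin c) → {a : Fin (q + 2) // cwLevel₃ a = I u p}) :=
                Fintype.card_congr (Equiv.subtypePiEquivPi
                  (p := fun p (a : Fin (q + 2)) => cwLevel₃ a = I u p))
            _ = _ := Fintype.card_pi
      _ = ∏ u, ∏ p, cwDim q (I u p) := by
          refine prod_congr rfl fun u _ => prod_congr rfl fun p _ => ?_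
          rw [Fintype.card_subtype, card_filter_cwLevel₃_eq]
  rw [h1, h2]
  simp only [cwDim]
  rw [← Finset.prod_product' (f := fun u p => if I u p = 1 then q else 1), Finset.prod_ite,
    prod_const_one, mul_one, prod_const]
  rfl

/-- **The exact count of Thm. 6.1**: the number of `X`-variables of a term with `k = 0` is
`M = ∑_Î q^{#1's(Î)}`, summed over the admissible level-1 `X`-sequences `Î` whose reversal `2 − Î` is
an admissible `Y`-sequence. [cite: VassilevskaWilliamsXuXuZhou2024, Thm. 6.1 (proof)] -/
theorem card_mmTermVars (T : InterfaceTerm c) (ε : ℝ) :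
    (mmTermVars q n T ε).card =
      ∑ I ∈ (termBlocksX n T ε).filter (fun I => revSeq I ∈ termBlocksY n T ε),
        q ^ (univ.filter fun up : Fin n × Fin c => I up.1 up.2 = 1).card := by
  classical
  rw [card_eq_sum_card_fiberwise (f := levelSeq) (s := mmTermVars q n T ε)
    (t := (termBlocksX n T ε).filter fun I => revSeq I ∈ termBlocksY n T ε)]
  · refine sum_congr rfl fun I hI => ?_
    rw [← card_filter_levelSeq_eq I]
    congr 1
    ext x
    simp only [mem_filter, mem_mmTermVars, mem_univ, true_and, levelSeq_cwDualSeq]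
    constructor
    · exact fun h => h.2
    · rintro rfl
      exact ⟨⟨(mem_filter.1 hI).1, (mem_filter.1 hI).2⟩, rfl⟩
  · intro x hx
    rw [Finset.mem_coe, mem_mmTermVars, levelSeq_cwDualSeq] at hx
    exact Finset.mem_coe.2 (mem_filter.2 hx)

/-- Complete split distributions of reversed sequences: `split(2 − Î, S)(σ) = split(Î, S)(2 − σ)`.
[cite: VassilevskaWilliamsXuXuZhou2024, §6 (input constraints)] -/
theorem completeSplitOn_revSeq (I : Fin n → Fin c → Fin 3) (S : Finset (Fin n)) (σ : Fin c → Fin 3) :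
    completeSplitOn (revSeq I) S σ = completeSplitOn I S (fun p => (σ p).rev) := by
  simp only [completeSplitOn]
  congr 3
  ext u
  simp only [mem_filter, funext_iff, revSeq_apply]
  refine and_congr Iff.rfl (forall_congr' fun p => ?_)
  constructor
  · intro h; rw [← h, Fin.rev_rev]
  · intro h; rw [h, Fin.rev_rev]

/-- **Under the input constraints of §6 the reversal condition is automatic**: if `i + j = 2c`
(`= 2^ℓ`, forced by `k = 0`) and `γ_Y(σ) = γ_X(2 − σ)` ("for every `t` with `k_t = 0`,
`γ_X^{(t)}(î) = γ_Y^{(t)}(2 − î)`"), then `2 − Î` is an admissible `Y`-sequence iff `Î` is an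
admissible `X`-sequence. [cite: VassilevskaWilliamsXuXuZhou2024, §6 (input constraints of the constituent stage)] -/
theorem revSeq_mem_termBlocksY_iff (T : InterfaceTerm c) (hij : T.i + T.j = 2 * c)
    (hγ : ∀ σ : Fin c → Fin 3, T.γY σ = T.γX (fun p => (σ p).rev)) (ε : ℝ) (I : Fin n → Fin c → Fin 3) :
    revSeq I ∈ termBlocksY n T ε ↔ I ∈ termBlocksX n T ε := by
  rw [termBlocksY, termBlocksX, levelBlocksY, levelBlocksX, mem_admissibleSeqs, mem_admissibleSeqs]
  refine and_congr (forall_congr' fun u => ?_) (forall_congr' fun t => ?_)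
  · have h := patternLevel_rev (I u)
    have hle := patternLevel_le (I u)
    change patternLevel (fun p => (I u p).rev) = T.j ↔ patternLevel (I u) = T.i
    omega
  · refine imp_congr_right fun _ => ?_
    simp only [SplitConsistentOn, completeSplitOn_revSeq, hγ]
    constructor
    · intro h σ
      have := h (fun p => (σ p).rev)
      simpa [Fin.rev_rev] using this
    · intro h σ
      exact h _

/-- **Thm. 6.1, the count under the input constraints**: `M = ∑_{Î ∈ X-blocks} q^{#1's(Î)}`.
[cite: VassilevskaWilliamsXuXuZhou2024, Thm. 6.1] -/
theorem card_mmTermVars_of_symm (T : InterfaceTerm c) (hij : T.i + T.j = 2 * c)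
    (hγ : ∀ σ : Fin c → Fin 3, T.γY σ = T.γX (fun p => (σ p).rev)) (ε : ℝ) :
    (mmTermVars q n T ε).card =
      ∑ I ∈ termBlocksX n T ε, q ^ (univ.filter fun up : Fin n × Fin c => I up.1 up.2 = 1).card := by
  rw [card_mmTermVars]
  congr 1
  ext I
  simp only [mem_filter, revSeq_mem_termBlocksY_iff T hij hγ, and_self]

end Count

/-! ## The exact count at tolerance `ε = 0`: `M = binom(n; nγ_X) · q^{n ∑_σ γ_X(σ) #1's(σ)}` -/

section ExactCount

variable {q c n : ℕ}

/-- **At `ε = 0` the level-1 `X`-blocks of a one-term tensor form one type class**: for `n ≥ 1` chunks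
and `γ_X = k/n` the type of a word of chunk shapes (`k` integral) supported on shapes of level `i`
(the first input constraint of §6: "if `î_1 + ⋯ + î_{2^{ℓ-1}} ≠ i_t` then `γ_X^{(t)}(î) = 0`"), the
level-1 `X`-sequences kept by `T^{⊗n}[γ_X, γ_Y, γ_Z]` are exactly the words of chunk shapes of type `k`.
[cite: VassilevskaWilliamsXuXuZhou2024, §6 (input constraints) and Def. 3.6] -/
theorem termBlocksX_zero_eq_typeClass (hn : 0 < n) (T : InterfaceTerm c) (k : (Fin c → Fin 3) → ℕ)
    (hk : ∀ σ, (k σ : ℝ) = n * T.γX σ) (hsupp : ∀ σ, k σ ≠ 0 → patternLevel σ = T.i) :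
    termBlocksX n T 0 = typeClass n k := by
  have hn' : (n : ℝ) ≠ 0 := by exact_mod_cast hn.ne'
  have huniv : ∀ t : Fin 1, (univ.filter fun u : Fin n => (fun _ : Fin n => (0 : Fin 1)) u = t) = univ := by
    intro t; ext u; simp [Subsingleton.elim (0 : Fin 1) t]
  have hne : ∀ t : Fin 1, (univ.filter fun u : Fin n => (fun _ : Fin n => (0 : Fin 1)) u = t).Nonempty := by
    intro t; rw [huniv]; exact univ_nonempty_iff.2 ⟨⟨0, hn⟩⟩
  -- consistency at `0` on all chunks is `letterCount = k`
  have hcons : ∀ I : Fin n → Fin c → Fin 3,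
      SplitConsistentOn 0 T.γX I univ ↔ letterCount I = k := by
    intro I
    rw [splitConsistentOn_zero_iff, funext_iff, funext_iff]
    refine forall_congr' fun σ => ?_
    rw [← completeSplit, completeSplit_apply, div_eq_iff hn', ← Nat.cast_inj (R := ℝ), hk, mul_comm]
  ext I
  simp only [termBlocksX, levelBlocksX, mem_admissibleSeqs, mem_typeClass]
  constructor
  · rintro ⟨-, h⟩
    have h0 := h 0 (hne 0)
    rw [huniv] at h0
    exact (hcons I).1 h0
  · intro hI
    refine ⟨fun u => ?_, fun t _ => ?_⟩
    · refine hsupp (I u) ?_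
      rw [← hI]
      exact (letterCount_pos_of_apply I u).ne'
    · rw [huniv]
      exact (hcons I).2 hI

/-- Hence their number is the multinomial coefficient `binom(n; k)` (`= 2^{n(H(γ_X) ± o(1))}`, Lemma 3.3;
the entropy bounds are `MultinomialEntropy.lean`). [cite: VassilevskaWilliamsXuXuZhou2024, Thm. 6.1 (proof, "the number of level-1 X-blocks … is 2^{n_t H(ξ) ± o(n)}")] -/
theorem card_termBlocksX_zero (hn : 0 < n) (T : InterfaceTerm c) (k : (Fin c → Fin 3) → ℕ)
    (hk : ∀ σ, (k σ : ℝ) = n * T.γX σ) (hsupp : ∀ σ, k σ ≠ 0 → patternLevel σ = T.i)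
    (hsum : ∑ σ, k σ = n) : (termBlocksX n T 0).card = Nat.multinomial univ k := by
  rw [termBlocksX_zero_eq_typeClass hn T k hk hsupp, card_typeClass_eq_multinomial n k hsum]

/-- The number of `1`'s of a level-1 sequence, regrouped by chunk shapes:
`#{(u,p) | Î_{u,p} = 1} = ∑_σ letterCount(Î)(σ) · #{p | σ_p = 1}`. [cite: VassilevskaWilliamsXuXuZhou2024, Thm. 6.1 (proof, "q^{∑_p [Î_p = 1]} = q^{n ∑_σ ξ(σ) ∑_p [σ_p = 1]}")] -/
theorem card_ones_eq_sum_letterCount (I : Fin n → Fin c → Fin 3) :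
    (univ.filter fun up : Fin n × Fin c => I up.1 up.2 = 1).card =
      ∑ σ, letterCount I σ * (univ.filter fun p => σ p = 1).card := by
  classical
  have h1 : (univ.filter fun up : Fin n × Fin c => I up.1 up.2 = 1).card =
      ∑ u, (univ.filter fun p => I u p = 1).card := by
    rw [card_eq_sum_ones, sum_filter, Fintype.sum_prod_type]
    refine sum_congr rfl fun u _ => ?_
    rw [card_eq_sum_ones, sum_filter]
  rw [h1, ← sum_fiberwise_of_maps_to (g := I) (t := univ) fun _ _ => mem_univ _]
  refine sum_congr rfl fun σ _ => ?_
  rw [sum_congr rfl fun u hu => by rw [(mem_filter.1 hu).2], sum_const, smul_eq_mul, letterCount_apply]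

/-- **VXXZ 2024, Theorem 6.1 — the size `M` of the inner product tensor, exactly, at `ε = 0`.**  For a
term with `k_t = 0`, `n_t = n ≥ 1` chunks, under the input constraints of §6 (`i_t + j_t = 2^ℓ`,
`γ_Y^{(t)}(σ) = γ_X^{(t)}(2 − σ)`, `γ_X^{(t)}` supported on shapes of level `i_t`) and with
`γ_X^{(t)} = k/n` the type of a word (integral, `∑ k = n`): the number of `X`-variables of
`T^{⊗n}[γ_X, γ_Y, γ_Z]` — the `M` with `T^{⊗n}[…] ≡ ⟨1, M, 1⟩` (`vxxz2024_thm61_iso`) — is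
`M = binom(n; k) · q^{∑_σ k(σ) #{p | σ_p = 1}}`, i.e. the printed
`M = 2^{n(H(γ_X) ± o(1))} · q^{n ∑_σ γ_X(σ) ∑_p [σ_p = 1]}` with the multinomial coefficient in place of
its entropy estimate (Lemma 3.3). [cite: VassilevskaWilliamsXuXuZhou2024, Thm. 6.1] -/
theorem vxxz2024_thm61_card (hn : 0 < n) (T : InterfaceTerm c) (hij : T.i + T.j = 2 * c)
    (hγ : ∀ σ : Fin c → Fin 3, T.γY σ = T.γX (fun p => (σ p).rev)) (k : (Fin c → Fin 3) → ℕ)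
    (hk : ∀ σ, (k σ : ℝ) = n * T.γX σ) (hsupp : ∀ σ, k σ ≠ 0 → patternLevel σ = T.i)
    (hsum : ∑ σ, k σ = n) :
    (mmTermVars q n T 0).card =
      Nat.multinomial univ k * q ^ (∑ σ, k σ * (univ.filter fun p : Fin c => σ p = 1).card) := by
  rw [card_mmTermVars_of_symm T hij hγ 0, termBlocksX_zero_eq_typeClass hn T k hk hsupp,
    ← card_typeClass_eq_multinomial n k hsum]
  rw [sum_congr rfl fun I hI => by rw [card_ones_eq_sum_letterCount, mem_typeClass.1 hI], sum_const,
    smul_eq_mul]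

end ExactCount

end Literature.Computability.AlgebraicComplexity
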